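import Summits.NavierStokesRegularity.NavierStokesRegularity.Theorems.QuantisedSymmetryPolyhedralDssProfileExistsOfCell
import HarnessLib

/-!
# The strategist's bridge stub `stub_cellConcatenatesToDss` of line polyhedral_cell
  (crux stmt-NavierStokesRegularity-1404 `QuantisedSymmetry.PolyhedralDssProfileExists`) — a corollary
  of the reduction `typeIDss_of_cell`

The alternative line `Lines/polyhedral_cell.lean` was registered by the crux strategist with two stubs,
`stub_polyhedralCellExists` (∃-side, open) and `stub_cellConcatenatesToDss` (bridge, L). The lead
(c14) reshaped the bridge into four stubs, all landed (`…StubCellConcatenation`, `…StubOseenMildOfSlabs`,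
`…StubDssL4Propagation`, `…StubClassicalOfOseenMildPast`) and assembled as `typeIDss_of_cell`
(`…OfCell.lean`). This file discharges the strategist's original bridge stub, still registered on the
item, as a corollary: a `G`-cell with `L⁴` datum concatenates to a classical, Oseen-mild, exactly
`c`-DSS, `G`-equivariant ancient field with the same slice at `t = -1`, slices in `L⁴` and
`L⁴`-continuous on `(-∞, 0)`.
-/

noncomputable section

-- the summit namespace `…NavierStokesRegularity.NavierStokesRegularity…` is the tree convention (D-0017)
set_option linter.dupNamespace false

namespace Summit.NavierStokesRegularity.NavierStokesRegularity.Theorems.PolyhedralDssProfileExists.PolyhedralCell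

open MeasureTheory Set Function Filter Topology
open Literature.Analysis.FluidPDE

/-- **STUB `stub_cellConcatenatesToDss` (strategist's bridge, line polyhedral_cell): a `G`-cell with
`L⁴` datum concatenates to a classical, Oseen-mild, `c`-DSS, `G`-equivariant ancient field with
`L⁴`-continuous slices** — immediate from `typeIDss_of_cell` (the Oseen equation between all pairs
`s < t < 0` is the `mild_eq` clause of the KNSS class `IsTypeIAncientMild`, and `C((-∞,0); L⁴)` is
`ContinuousInLpOn (Iio 0) 4 u`). -/
theorem stub_cellConcatenatesToDss :
    ∀ (G : Subgroup (EuclideanSpace ℝ (Fin 3) ≃ₗᵢ[ℝ] EuclideanSpace ℝ (Fin 3))) (c : ℝ), 1 < c →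
    ∀ v : ℝ → EuclideanSpace ℝ (Fin 3) → EuclideanSpace ℝ (Fin 3),
      (ContinuousOn (Function.uncurry v) (Set.Icc (-1 : ℝ) (-(c ^ 2)⁻¹) ×ˢ Set.univ) ∧
        (∃ M : ℝ, ∀ t ∈ Set.Icc (-1 : ℝ) (-(c ^ 2)⁻¹), ∀ x, ‖v t x‖ ≤ M) ∧
        (∀ t ∈ Set.Icc (-1 : ℝ) (-(c ^ 2)⁻¹), IsWeaklyDivFree (v t)) ∧
        (∀ s t : ℝ, -1 ≤ s → s < t → t ≤ -(c ^ 2)⁻¹ → ∀ x,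
          v t x = heatFlow (v s) (t - s) x - oseenDuhamel 1 s v v t x) ∧
        (∀ x, v (-(c ^ 2)⁻¹) x = c • v (-1) (c • x)) ∧
        (∀ g ∈ G, ∀ t ∈ Set.Icc (-1 : ℝ) (-(c ^ 2)⁻¹), ∀ x, v t (g x) = g (v t x))) →
      MemLp (v (-1)) 4 volume →
      ∃ (u : ℝ → EuclideanSpace ℝ (Fin 3) → EuclideanSpace ℝ (Fin 3))
        (p : ℝ → EuclideanSpace ℝ (Fin 3) → ℝ),
        IsClassicalNSSolutionOn (Set.Iio 0) 1 0 u p ∧ IsDiscretelySelfSimilar c u ∧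
        (∀ g ∈ G, ∀ t x, u t (g x) = g (u t x)) ∧ u (-1) = v (-1) ∧
        (∀ s t : ℝ, s < t → t < 0 → ∀ x, u t x = heatFlow (u s) (t - s) x - oseenDuhamel 1 s u u t x) ∧
        (∀ t < 0, MemLp (u t) 4 volume) ∧
        (∀ t₀ < 0, Filter.Tendsto (fun t => eLpNorm (u t - u t₀) 4 volume)
          (nhdsWithin t₀ (Set.Iio 0)) (nhds 0)) := by
  intro G c hc v hcell hL4
  obtain ⟨u, p, hcl, -, -, hdss, ⟨C₀, -, -, hK⟩, heqv, hu1, hL4u⟩ := typeIDss_of_cell G hc hcell hL4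
  exact ⟨u, p, hcl, hdss, heqv, hu1, fun s t hst ht x => hK.mild_eq hst ht x, hL4u.1, hL4u.2⟩

end Summit.NavierStokesRegularity.NavierStokesRegularity.Theorems.PolyhedralDssProfileExists.PolyhedralCell

end
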